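import Literature.Computability.Complexity.MonotoneCliqueKWDepth
import HarnessLib

/-!
# Raz–Wigderson Thm. 4.1: monotone circuits for PERFECT MATCHING need linear depth — PROVED

R. Raz, A. Wigderson, *Monotone circuits for matching require linear depth*, STOC 1990 / J. ACM 39
(1992) (materialised `paper:doi-10-1145-100216-100253`), §4.1 (p. 12–13): «PM: Does `G` on vertex
set `N` have a perfect matching?» and **Theorem 4.1**: «`d_m(PM) = Ω(n)`» (there from the Main
Theorem on `MATCH` by adding `m` universal vertices).

Here from the BIPARTITE bound of the tree (`RWMatching.bpm_monotoneKW_depth`,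
`MonotoneMatchingKWDepth.lean`) by restriction (RW Fact 2.1, `KWTree.solvesMono_restrict` of
`MonotoneCliqueKWDepth.lean`): the bipartite perfect matching function of `K_{n,n}` IS the perfect
matching function of `K_{2n}` with all edges inside the two sides switched off
(`pmFn_extendAlong`), so a monotone circuit for `PM` on `2n` vertices is at least as deep as one for
`BPM` on `n + n`.

* `RWPerfectMatching.pmFn N` — the perfect matching function of `K_N` on edge indicators: «`G` has a
  perfect matching», a perfect matching being presented as a fixed-point-free involution `σ` of the
  vertices all of whose pairs `{v, σ v}` are edges of `G`.
* `RWPerfectMatching.pmFn_extendAlong` — `PM_{2n}(x extended by zeros) = BPM_n(x)`.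
* `RWPerfectMatching.pm_monotoneKW_depth`, `RWPerfectMatching.pm_monotoneDepth` — ★ Thm. 4.1: the
  monotone Karchmer–Wigderson game / every monotone circuit of `pmFn (n+n)` needs depth `≥ c · n`
  (`n ≥ n₀`).

0 named facts.
-/

noncomputable section

namespace Literature.Computability.Complexity

open Finset Literature.Barriers.PneNP

namespace RWPerfectMatching

open RWClique (Edge)

variable {N n : ℕ}

/-- **The perfect matching function `PM` of `K_N`** on edge indicators `x`: the graph has a perfect
matching, i.e. there is a fixed-point-free involution `σ` of the vertex set all of whose pairs
`{v, σ v}` are edges (`x = 1`).  Monotone. [cite: RazWigderson1990, §4.1 ("PM: Does G on vertex set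
N have a perfect matching?", p. 12)] -/
def pmFn (N : ℕ) (x : Edge N → Bool) : Bool :=
  decide (∃ σ : Equiv.Perm (Fin N), ∃ h : ∀ v, σ v ≠ v, (∀ v, σ (σ v) = v) ∧
    ∀ v, x ⟨s(v, σ v), by simpa using (h v).symm⟩ = true)

/-- Unfolding `pmFn`. [cite: RazWigderson1990, §4.1 (p. 12)] -/
theorem pmFn_eq_true_iff (x : Edge N → Bool) :
    pmFn N x = true ↔ ∃ σ : Equiv.Perm (Fin N), ∃ h : ∀ v, σ v ≠ v, (∀ v, σ (σ v) = v) ∧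
      ∀ v, x ⟨s(v, σ v), by simpa using (h v).symm⟩ = true := by
  simp [pmFn]

/-- The bipartite coordinates inside `K_{n+n}`: `(l, r) ↦ {l, r̄}`.
[cite: RazWigderson1990, Thm. 4.2 (vertex duplication, p. 13)] -/
def embB (p : Fin n × Fin n) : Edge (n + n) :=
  ⟨s(finSumFinEquiv (Sum.inl p.1), finSumFinEquiv (Sum.inr p.2)), by
    rw [SimpleGraph.mem_edgeSet, SimpleGraph.top_adj]
    exact finSumFinEquiv.injective.ne Sum.inl_ne_inr⟩

/-- `embB` is injective. [cite: RazWigderson1990, Thm. 4.2] -/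
theorem embB_injective : Function.Injective (embB (n := n)) := by
  intro p q h
  have h' := congrArg Subtype.val h
  simp only [embB] at h'
  rw [Sym2.eq_iff] at h'
  rcases h' with ⟨h1, h2⟩ | ⟨h1, h2⟩
  · exact Prod.ext (by simpa using finSumFinEquiv.injective h1) (by simpa using finSumFinEquiv.injective h2)
  · exact absurd (finSumFinEquiv.injective h1) (by simp)

/-- An edge of `K_{n+n}` whose underlying pair is `{l, r̄}` is the embedded coordinate `(l, r)`, so
the extended input reads `x (l, r)` there. [cite: RazWigderson1990, Thm. 4.2] -/
theorem extendAlong_of_val_eq {x : Fin n × Fin n → Bool} {ε : Edge (n + n)} {l r : Fin n}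
    (hε : ε.1 = s(finSumFinEquiv (Sum.inl l), finSumFinEquiv (Sum.inr r))) (hx : x (l, r) = true) :
    KWTree.extendAlong embB x ε = true := by
  have : ε = embB (l, r) := Subtype.ext hε
  rw [this, KWTree.extendAlong_apply embB_injective]
  exact hx

/-- Conversely, an edge `{l, w}` switched on in the extended input is `{l, r̄}` with `x (l, r) = 1`.
[cite: RazWigderson1990, Thm. 4.2] -/
theorem exists_of_extendAlong_inl {x : Fin n × Fin n → Bool} {l : Fin n} {w : Fin (n + n)}
    (hw : s(finSumFinEquiv (Sum.inl l), w) ∈ (⊤ : SimpleGraph (Fin (n + n))).edgeSet)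
    (h : KWTree.extendAlong embB x ⟨s(finSumFinEquiv (Sum.inl l), w), hw⟩ = true) :
    ∃ r, w = finSumFinEquiv (Sum.inr r) ∧ x (l, r) = true := by
  obtain ⟨p, hp, hxp⟩ := KWTree.extendAlong_eq_true h
  have hv := congrArg Subtype.val hp
  simp only [embB] at hv
  rw [Sym2.eq_iff] at hv
  rcases hv with ⟨h1, h2⟩ | ⟨h1, h2⟩
  · have hl : p.1 = l := by simpa using finSumFinEquiv.injective h1
    refine ⟨p.2, h2.symm, ?_⟩
    rw [← hl]
    exact hxp
  · exact absurd (finSumFinEquiv.injective h2) (by simp)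

/-- **`BPM_n` is the restriction of `PM_{2n}`**: switching off all edges inside the two sides of
`K_{n+n}`, the perfect matching function becomes the bipartite perfect matching function
`perfectMatchingFn n` (perfect matchings of the bipartite graph = fixed-point-free involutions
exchanging the sides = permutations `σ` with all `(i, σ i)` edges).
[cite: RazWigderson1990, Thm. 4.1/4.2 (pp. 12–13)] -/
theorem pmFn_extendAlong (x : Fin n × Fin n → Bool) :
    pmFn (n + n) (KWTree.extendAlong embB x) = perfectMatchingFn n x := by
  classical
  set E : Fin n ⊕ Fin n ≃ Fin (n + n) := finSumFinEquiv with hE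
  rw [Bool.eq_iff_iff, pmFn_eq_true_iff, perfectMatchingFn_eq_true_iff]
  constructor
  · rintro ⟨τ, hfix, -, hedge⟩
    have key : ∀ l : Fin n, ∃ r : Fin n, τ (E (Sum.inl l)) = E (Sum.inr r) ∧ x (l, r) = true :=
      fun l => exists_of_extendAlong_inl _ (hedge (E (Sum.inl l)))
    choose σf hσf using key
    have hinj : Function.Injective σf := by
      intro l l' h
      have h1 := (hσf l).1
      have h2 := (hσf l').1
      rw [h, ← h2] at h1
      simpa [hE] using τ.injective h1
    refine ⟨Equiv.ofBijective σf (Finite.injective_iff_bijective.mp hinj), fun i => ?_⟩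
    exact (hσf i).2
  · rintro ⟨σ, hσ⟩
    let g : Fin n ⊕ Fin n → Fin n ⊕ Fin n :=
      Sum.elim (fun l => Sum.inr (σ l)) (fun r => Sum.inl (σ.symm r))
    have hg : Function.Involutive g := by
      rintro (l | r) <;> simp [g]
    let τf : Fin (n + n) → Fin (n + n) := fun v => E (g (E.symm v))
    have hτ : Function.Involutive τf := fun v => by simp [τf, hg _]
    refine ⟨hτ.toPerm _, fun v h => ?_, fun v => hτ v, fun v => ?_⟩
    · -- no fixed points
      have h' : g (E.symm v) = E.symm v := by
        have := congrArg E.symm h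
        simpa [τf] using this
      rcases hw : E.symm v with l | r <;> rw [hw] at h' <;> simp [g] at h'
    · -- all pairs are edges
      rcases hw : E.symm v with l | r
      · have hv : v = E (Sum.inl l) := by rw [← hw, Equiv.apply_symm_apply]
        refine extendAlong_of_val_eq (l := l) (r := σ l) ?_ (hσ l)
        simp only [Function.Involutive.coe_toPerm, τf, hv, g, Equiv.symm_apply_apply, Sum.elim_inl]
        rfl
      · have hv : v = E (Sum.inr r) := by rw [← hw, Equiv.apply_symm_apply]
        refine extendAlong_of_val_eq (l := σ.symm r) (r := r) ?_ ?_
        · dsimp only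
          rw [Sym2.eq_swap]
          simp only [Function.Involutive.coe_toPerm, τf, hv, g, Equiv.symm_apply_apply, Sum.elim_inr]
          rfl
        · have := hσ (σ.symm r)
          rwa [Equiv.apply_symm_apply] at this

/-- `pmFn` is monotone in the edge set. [cite: RazWigderson1990, §4.1 ("monotone functions on
graphs", p. 12)] -/
theorem pmFn_monotone (N : ℕ) : Monotone (pmFn N) := by
  intro x y hxy
  cases hx : pmFn N x
  · exact Bool.false_le _
  · obtain ⟨σ, hfix, hinv, hedge⟩ := (pmFn_eq_true_iff x).1 hx
    refine ((pmFn_eq_true_iff y).2 ⟨σ, hfix, hinv, fun v => ?_⟩).ge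
    have := hxy ⟨s(v, σ v), by simpa using (hfix v).symm⟩
    rw [hedge v] at this
    exact Bool.eq_true_of_true_le this

/-- ★ **Raz–Wigderson Thm. 4.1, communication form**: there are `c > 0`, `m₀` such that for
`m ≥ m₀`, `n = 2m + r`, every protocol tree solving the monotone Karchmer–Wigderson game of the
perfect matching function `pmFn (n+n)` of `K_{2n}` has depth `≥ c · m` — by restriction to the
bipartite game (`pmFn_extendAlong`, `KWTree.solvesMono_restrict`) and
`RWMatching.bpm_monotoneKW_depth`. [cite: RazWigderson1990, Thm. 4.1 (p. 13)] -/
theorem pm_monotoneKW_depth :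
    ∃ c : ℝ, 0 < c ∧ ∃ m₀ : ℕ, ∀ (m r n : ℕ), m₀ ≤ m → 2 * m + r = n →
      ∀ P : KWTree (Edge (n + n)), P.SolvesMono (pmFn (n + n)) → c * m ≤ (P.depth : ℝ) := by
  classical
  obtain ⟨c, hc, m₀, H⟩ := RWMatching.bpm_monotoneKW_depth
  refine ⟨c, hc, max m₀ 1, fun m r n hm hn P hP => ?_⟩
  have hn0 : 0 < n := by omega
  have hP' := KWTree.solvesMono_restrict ((⟨0, hn0⟩, ⟨0, hn0⟩) : Fin n × Fin n) embB_injective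
    (pmFn (n + n)) hP
  have hfun : (fun x => pmFn (n + n) (KWTree.extendAlong embB x)) = perfectMatchingFn n := by
    funext x
    exact pmFn_extendAlong x
  rw [hfun] at hP'
  have key := H m r n (le_trans (le_max_left _ _) hm) hn _ hP'
  rwa [KWTree.depth_transport] at key

/-- ★ **Raz–Wigderson Thm. 4.1, circuit form: `d_m(PM) = Ω(n)`.**  There are `c > 0`, `n₀` such
that for `n ≥ n₀` every monotone circuit (`{∧₂, ∨₂}`) computing the perfect matching function
`pmFn (n+n)` of `K_{2n}` has depth `≥ c · n` (Karchmer–Wigderson simulation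
`Circuit.exists_kwTree_solvesMono` + `pm_monotoneKW_depth`). [cite: RazWigderson1990, Thm. 4.1
(p. 13: "d_m(PM) = Ω(n)")] -/
theorem pm_monotoneDepth :
    ∃ c : ℝ, 0 < c ∧ ∃ n₀ : ℕ, ∀ n ≥ n₀, ∀ C : Circuit (Edge (n + n)),
      C.IsOver monotoneBasis → C.Computes (pmFn (n + n)) → c * n ≤ (C.depth : ℝ) := by
  obtain ⟨c, hc, m₀, H⟩ := pm_monotoneKW_depth
  refine ⟨c / 4, by positivity, 2 * m₀ + 4, fun n hn C hO hC => ?_⟩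
  obtain ⟨T, hT, hd⟩ := C.exists_kwTree_solvesMono hO hC
  have key := H (n / 2) (n % 2) n (by omega) (by omega) T hT
  have h1 : (T.depth : ℝ) ≤ C.depth := by exact_mod_cast hd
  have h2 : (n : ℝ) ≤ 2 * ((n / 2 : ℕ) : ℝ) + 1 := by
    have : n ≤ 2 * (n / 2) + 1 := by omega
    exact_mod_cast this
  have h3 : (4 : ℝ) ≤ n := by exact_mod_cast (by omega : 4 ≤ n)
  have h4 : c * n ≤ c * (2 * ((n / 2 : ℕ) : ℝ) + 1) := mul_le_mul_of_nonneg_left h2 hc.le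
  have h5 : c * 4 ≤ c * n := mul_le_mul_of_nonneg_left h3 hc.le
  linarith

end RWPerfectMatching

end Literature.Computability.Complexity

end
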